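import Summits.AnomalousDissipation.AnomalousDissipation.Theorems.SolenoidalFractalHomogenisationLagrangianStepSidebandLadderDefs
import HarnessLib

/-!
# K1L_D `stub_D1_V0thg` (stmt-AnomalousDissipation-27980), R3′ lane «SidebandTailCrushing» (tenure D28-16 (3) / D28-20) — file F4a:
# LADDER ALGEBRA — skewness of the slot's link operator, the bond operator `C = [K, hopL]`, `[K, C] = hopL`, site-diagonal commutations, invariance

Helper file of route `SolenoidalFractalHomogenisation` (prover seat `ad-k1l-cellLawV-w1` g10; plan memo
`Cruxes/LagrangianRenormalisationStepDesign/Lines/onelevel-vtheta-R3-plan.md` §3–§4; `--supports stmt-AnomalousDissipation-27980 --as helper`).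
The structural (constant-free) hypotheses of `LadderCrush.hypocoercive_decay'` for the sideband instance of file F3 (`indexL` = K, `hopL` = the slot's link
operator at unit envelope, `dampL` = damping, `ladderSub` = V), all over the REAL inner product of `Sideband.Space R` (`real_inner_space_eq_sum`):
* `slotEnvelope_midpoint` (`envᵢ(startᵢ + τᵢ/2) = 1`) ⇒ **`real_inner_hopL_self`** (`⟪hopL y, y⟫_ℝ = 0`, from TREE `sum_re_inner_link_eq_zero` at the midpoint)
  ⇒ **`real_inner_hopL_comm`** (`⟪hopL u, v⟫_ℝ = −⟪u, hopL v⟫_ℝ`, polarisation);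
* `real_inner_diagL_comm` (real weights are symmetric), `diagL_dampL_comm` (site-diagonal operators commute), `diagL_diagL_comm`;
* **`indexL_hopL_sub_apply`**: `(K hopL − hopL K) y` at `z` is `hopCoeffᵢ(z) • P_z(αᵢ P y_{z−m} − ᾱᵢ P y_{z+m})` (uses `siteIndex (z ± m) = siteIndex z ± 1`), and
  **`indexL_bond_sub_apply`**: commuting once more with `K` gives back `hopL` — the ladder relations `[K,S] = S`, `[K,S*] = −S*`;
* invariance of `ladderSub R L` under `diagL`, `dampL`, and — for `L` closed under `± mᵢ` — under `hopL` and the bond operator.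
No definitions, no sorry.  NOT a proof of `stub_D1_V0thg`, of K1L_D or of AD; rung F-D1.A0 infrastructure.
-/

set_option linter.dupNamespace false -- single-conjunct summit: `Summit.AnomalousDissipation.AnomalousDissipation.…` is the mandated namespace

noncomputable section

namespace Summit.AnomalousDissipation.AnomalousDissipation.Theorems.SolenoidalFractalHomogenisation.LagrangianStep.Sideband

open Set Complex
open scoped InnerProductSpace
open Literature.Analysis Literature.Analysis.FunctionSpaces Literature.Analysis.FunctionSpaces.Torus
open Literature.Analysis.FluidPDE Literature.Analysis.FluidPDE.Torus Literature.Analysis.FluidPDE.LatticeShear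
open Summit.AnomalousDissipation.AnomalousDissipation.Theorems.SolenoidalFractalHomogenisation.LagrangianStep.CellChain (linkCoeff kdot_transversalProj')
open Summit.AnomalousDissipation.AnomalousDissipation.Theorems.SolenoidalFractalHomogenisation.PermissibleCarrier
  (period_pos start_nonneg start_add_tau_le_period)

variable {k₀ : ℕ}

/-! ## §1 The envelope at the slot midpoint and the skewness of `hopL` -/

/-- At the midpoint of its slot the envelope of slot `i` equals `1` (ramp `ρ ≤ 1/2`: `min(1, 1/(2ρ)) = 1`). [cite: ArmstrongVicol2025, §4 p. 17 (time cutoff)] -/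
theorem slotEnvelope_midpoint (W₁ : LatticeWord k₀) (i : Fin k₀) : slotEnvelope W₁ i (W₁.start i + (W₁.phase i).τ / 2) = 1 := by
  have hP := period_pos W₁
  have hs0 := start_nonneg W₁ i
  have hsP := start_add_tau_le_period W₁ i
  have hτ := (W₁.phase i).τ_pos
  have hρ := W₁.ramp_pos
  have hρ2 := W₁.ramp_le
  set t : ℝ := W₁.start i + (W₁.phase i).τ / 2 with ht
  have ht0 : 0 ≤ t := by rw [ht]; positivity
  have htP : t < W₁.period := by rw [ht]; linarith
  have hfr : Int.fract (t / W₁.period) * W₁.period = t := by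
    rw [Int.fract_eq_self.2 ⟨div_nonneg ht0 hP.le, (div_lt_one hP).2 htP⟩, div_mul_cancel₀ t hP.ne']
  rw [slotEnvelope_def, hfr, LatticeWord.trapezoid]
  have hρτ : 0 < W₁.ramp * (W₁.phase i).τ := mul_pos hρ hτ
  have e1 : (t - W₁.start i) / (W₁.ramp * (W₁.phase i).τ) = 1 / (2 * W₁.ramp) := by
    rw [ht]; field_simp; ring
  have e2 : (W₁.start i + (W₁.phase i).τ - t) / (W₁.ramp * (W₁.phase i).τ) = 1 / (2 * W₁.ramp) := by
    rw [ht]; field_simp; ring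
  rw [e1, e2, min_self]
  have hge : (1 : ℝ) ≤ 1 / (2 * W₁.ramp) := by rw [le_div_iff₀ (by positivity)]; linarith
  rw [min_eq_left hge, max_eq_right zero_le_one]

/-- **`hopL` creates no energy**: `⟪hopL y, y⟫_ℝ = 0` (TREE `sum_re_inner_link_eq_zero` at the slot midpoint, where `linkCoeffᵢ = −hopCoeffᵢ`).
[cite: MeshalkinSinai1961, pp. 1700–1705] -/
theorem real_inner_hopL_self (W₁ : LatticeWord k₀) (R : ℕ) (i : Fin k₀) (y : Space R) : ⟪hopL W₁ R i y, y⟫_ℝ = 0 := by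
  set t : ℝ := W₁.start i + (W₁.phase i).τ / 2 with ht
  have henv : slotEnvelope W₁ i t = 1 := slotEnvelope_midpoint W₁ i
  have hskew := sum_re_inner_link_eq_zero W₁ R i t y
  rw [real_inner_space_eq_sum]
  have key : ∀ z : box R, (⟪hopL W₁ R i y z, y z⟫_ℂ).re = -(⟪linkCoeff W₁ 1 z.1 i t • transversalProj z.1
        (slotAmp W₁ i • transversalProj (z.1 - (W₁.phase i).m) (coordL R (z.1 - (W₁.phase i).m) y) +
          starRingEnd ℂ (slotAmp W₁ i) • transversalProj (z.1 + (W₁.phase i).m) (coordL R (z.1 + (W₁.phase i).m) y)), y z⟫_ℂ).re := by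
    intro z
    rw [hopL_apply, linkBlock_apply, linkCoeff_eq_neg_slotEnvelope_mul_hopCoeff, henv]
    push_cast
    rw [one_mul, neg_smul, inner_neg_left, Complex.neg_re, neg_neg]
  simp_rw [key]
  rw [Finset.sum_neg_distrib, hskew, neg_zero]

/-- **`hopL` is skew for the real inner product**: `⟪hopL u, v⟫_ℝ = −⟪u, hopL v⟫_ℝ` (polarisation of `real_inner_hopL_self`).
[cite: MeshalkinSinai1961, pp. 1700–1705] -/
theorem real_inner_hopL_comm (W₁ : LatticeWord k₀) (R : ℕ) (i : Fin k₀) (u v : Space R) :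
    ⟪hopL W₁ R i u, v⟫_ℝ = -⟪u, hopL W₁ R i v⟫_ℝ := by
  have h := real_inner_hopL_self W₁ R i (u + v)
  rw [map_add, inner_add_left, inner_add_right, inner_add_right, real_inner_hopL_self, real_inner_hopL_self, zero_add, add_zero] at h
  rw [← real_inner_comm u (hopL W₁ R i v)]
  linarith

/-! ## §2 Real weights: symmetry and commutation -/

/-- Real fibrewise weights are symmetric: `⟪diagL w u, v⟫_ℝ = ⟪u, diagL w v⟫_ℝ`. [folklore] -/
theorem real_inner_diagL_comm (R : ℕ) (w : (Fin 3 → ℤ) → ℝ) (u v : Space R) : ⟪diagL R w u, v⟫_ℝ = ⟪u, diagL R w v⟫_ℝ := by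
  rw [real_inner_space_eq_sum, real_inner_space_eq_sum]
  refine Finset.sum_congr rfl fun z _ => ?_
  rw [diagL_apply, diagL_apply, inner_smul_left, inner_smul_right, Complex.conj_ofReal]

/-- Two real weights commute. [folklore] -/
theorem diagL_diagL_comm (R : ℕ) (w w' : (Fin 3 → ℤ) → ℝ) (y : Space R) : diagL R w (diagL R w' y) = diagL R w' (diagL R w y) := by
  ext z : 1
  rw [diagL_apply, diagL_apply, diagL_apply, diagL_apply, smul_smul, smul_smul, mul_comm]

/-- A real weight commutes with the (site-diagonal) damping. [cite: MajdaKramer1999, §2.2.1.3] -/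
theorem diagL_dampL_comm (R : ℕ) (w : (Fin 3 → ℤ) → ℝ) (𝔸 : Torus.Visc4 (Fin 3)) (γ₁ : ℝ) (y : Space R) :
    diagL R w (dampL 𝔸 γ₁ R y) = dampL 𝔸 γ₁ R (diagL R w y) := by
  ext z : 1
  rw [diagL_apply, dampL_apply, dampL_apply, dampComp_apply, dampComp_apply, diagL_apply]
  simp only [map_smul, Torus.symbT_smul, smul_add, smul_sub, smul_smul]
  module

/-- The weighted state read through `coordL`: `coordL z (diagL w y) = w z • coordL z y`. [folklore] -/
theorem coordL_diagL (R : ℕ) (w : (Fin 3 → ℤ) → ℝ) (y : Space R) (z : Fin 3 → ℤ) :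
    coordL R z (diagL R w y) = ((w z : ℝ) : ℂ) • coordL R z y := by
  by_cases hz : z ∈ box R
  · rw [coordL_apply_of_mem hz, coordL_apply_of_mem hz]; exact diagL_apply R w y ⟨z, hz⟩
  · rw [coordL_apply_of_not_mem hz, coordL_apply_of_not_mem hz, smul_zero]

/-! ## §3 The bond operator `C = [K, hopL]` and `[K, C] = hopL` -/

/-- **The bond operator, componentwise**: `(K hopL y − hopL K y)_z = hopCoeffᵢ(z) • P_z(αᵢ P y_{z−mᵢ} − ᾱᵢ P y_{z+mᵢ})` (`κ(z∓m) = κ(z) ∓ 1`).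
[cite: BedrossianCotiZelati2017, §2 (the commutator [∂_y, u])] -/
theorem indexL_hopL_sub_apply (W₁ : LatticeWord k₀) (R : ℕ) (i : Fin k₀) (hm : zdot (W₁.phase i).m (W₁.phase i).m ≠ 0) (y : Space R) (z : box R) :
    (indexL R (W₁.phase i).m (hopL W₁ R i y) - hopL W₁ R i (indexL R (W₁.phase i).m y)) z =
      hopCoeff W₁ i z.1 • transversalProj z.1
        (slotAmp W₁ i • transversalProj (z.1 - (W₁.phase i).m) (coordL R (z.1 - (W₁.phase i).m) y) -
          starRingEnd ℂ (slotAmp W₁ i) • transversalProj (z.1 + (W₁.phase i).m) (coordL R (z.1 + (W₁.phase i).m) y)) := by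
  rw [PiLp.sub_apply, indexL_apply, hopL_apply, hopL_apply, linkBlock_apply, linkBlock_apply, indexL, coordL_diagL, coordL_diagL,
    siteIndex_sub_self hm, siteIndex_add_self hm]
  simp only [map_smul, map_add, map_sub, smul_add, smul_sub, smul_smul]
  push_cast
  module

/-- **Commuting the bond operator with `K` gives back `hopL`**, componentwise:
`(K C y − C K y)_z = (hopL y)_z` for `C y := K hopL y − hopL K y`. [cite: BedrossianCotiZelati2017, §2] -/
theorem indexL_bond_sub_apply (W₁ : LatticeWord k₀) (R : ℕ) (i : Fin k₀) (hm : zdot (W₁.phase i).m (W₁.phase i).m ≠ 0) (y : Space R) (z : box R) :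
    (indexL R (W₁.phase i).m (indexL R (W₁.phase i).m (hopL W₁ R i y) - hopL W₁ R i (indexL R (W₁.phase i).m y)) -
        (indexL R (W₁.phase i).m (hopL W₁ R i (indexL R (W₁.phase i).m y)) -
          hopL W₁ R i (indexL R (W₁.phase i).m (indexL R (W₁.phase i).m y)))) z = hopL W₁ R i y z := by
  have h1 := indexL_hopL_sub_apply W₁ R i hm y z
  have h2 := indexL_hopL_sub_apply W₁ R i hm (indexL R (W₁.phase i).m y) z
  rw [PiLp.sub_apply, indexL_apply, h1, h2, hopL_apply, linkBlock_apply, indexL, coordL_diagL, coordL_diagL,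
    siteIndex_sub_self hm, siteIndex_add_self hm]
  simp only [map_smul, map_add, map_sub, smul_add, smul_sub, smul_smul]
  push_cast
  module

/-! ## §4 Invariance of the ladder subspace -/

/-- A state of `ladderSub R L` read off `L` through `coordL` vanishes. [cite: MajdaKramer1999, §2.2.1.3] -/
theorem coordL_eq_zero_of_mem_ladderSub {R : ℕ} {L : Set (Fin 3 → ℤ)} {y : Space R} (hy : y ∈ ladderSub R L) {w : Fin 3 → ℤ}
    (hw : w ∉ L) : coordL R w y = 0 := by
  by_cases hb : w ∈ box R
  · rw [coordL_apply_of_mem hb]; exact apply_eq_zero_of_mem_ladderSub hy (z := ⟨w, hb⟩) hw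
  · exact coordL_apply_of_not_mem hb y

/-- Every fibre of a state of `ladderSub R L`, read through `coordL`, is transversal. [cite: Temam1984, Ch. III §1.1] -/
theorem kdot_coordL_of_mem_ladderSub {R : ℕ} {L : Set (Fin 3 → ℤ)} {y : Space R} (hy : y ∈ ladderSub R L) (w : Fin 3 → ℤ) :
    kdot w (coordL R w y) = 0 := by
  by_cases hb : w ∈ box R
  · rw [coordL_apply_of_mem hb]; exact kdot_eq_zero_of_mem_ladderSub hy ⟨w, hb⟩
  · rw [coordL_apply_of_not_mem hb, map_zero]

/-- Real weights preserve the ladder subspace. [folklore] -/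
theorem diagL_mem_ladderSub {R : ℕ} {L : Set (Fin 3 → ℤ)} (w : (Fin 3 → ℤ) → ℝ) {y : Space R} (hy : y ∈ ladderSub R L) :
    diagL R w y ∈ ladderSub R L := by
  refine mem_ladderSub.2 fun z => ⟨fun hz => ?_, ?_⟩
  · rw [diagL_apply, apply_eq_zero_of_mem_ladderSub hy hz, smul_zero]
  · rw [diagL_apply, map_smul, kdot_eq_zero_of_mem_ladderSub hy z, smul_zero]

/-- The site-index operator preserves the ladder subspace. [cite: BedrossianCotiZelati2017, §2] -/
theorem indexL_mem_ladderSub {R : ℕ} {L : Set (Fin 3 → ℤ)} (m : Fin 3 → ℤ) {y : Space R} (hy : y ∈ ladderSub R L) :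
    indexL R m y ∈ ladderSub R L :=
  diagL_mem_ladderSub (siteIndex m) hy

/-- The damping preserves the ladder subspace. [cite: MajdaKramer1999, §2.2.1.3] -/
theorem dampL_mem_ladderSub {R : ℕ} {L : Set (Fin 3 → ℤ)} (𝔸 : Torus.Visc4 (Fin 3)) (γ₁ : ℝ) {y : Space R} (hy : y ∈ ladderSub R L) :
    dampL 𝔸 γ₁ R y ∈ ladderSub R L := by
  refine mem_ladderSub.2 fun z => ⟨fun hz => ?_, ?_⟩
  · have h0 : Torus.symbT (Torus.majorTranspose 𝔸) z.1 0 = 0 := (symbTL (Torus.majorTranspose 𝔸) z.1).map_zero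
    rw [dampL_apply, dampComp_apply, apply_eq_zero_of_mem_ladderSub hy hz, map_zero, h0, map_zero, smul_zero, sub_zero,
      smul_zero, add_zero]
  · rw [dampL_apply, dampComp_apply, transversalProj_apply_of_mem_ladderSub hy z, sub_self, smul_zero, add_zero, map_smul,
      kdot_transversalProj', smul_zero]

/-- The slot's link operator preserves the ladder subspace of any set `L` closed under `± mᵢ`. [cite: MeshalkinSinai1961, pp. 1700–1705] -/
theorem hopL_mem_ladderSub (W₁ : LatticeWord k₀) {R : ℕ} (i : Fin k₀) {L : Set (Fin 3 → ℤ)}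
    (hadd : ∀ z, z + (W₁.phase i).m ∈ L → z ∈ L) (hsub : ∀ z, z - (W₁.phase i).m ∈ L → z ∈ L) {y : Space R} (hy : y ∈ ladderSub R L) :
    hopL W₁ R i y ∈ ladderSub R L := by
  refine mem_ladderSub.2 fun z => ⟨fun hz => ?_, ?_⟩
  · have h1 : z.1 - (W₁.phase i).m ∉ L := fun h => hz (hsub z.1 h)
    have h2 : z.1 + (W₁.phase i).m ∉ L := fun h => hz (hadd z.1 h)
    rw [hopL_apply, linkBlock_apply, coordL_eq_zero_of_mem_ladderSub hy h1, coordL_eq_zero_of_mem_ladderSub hy h2, map_zero, map_zero,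
      smul_zero, smul_zero, add_zero, map_zero, smul_zero]
  · rw [hopL_apply, linkBlock_apply, map_smul, kdot_transversalProj', smul_zero]

/-- The slot's link operator preserves the ladder subspace of an `mᵢ`-ladder. [cite: MeshalkinSinai1961, pp. 1700–1705] -/
theorem hopL_mem_ladderSub_ladder (W₁ : LatticeWord k₀) {R : ℕ} (i : Fin k₀) (z₀ : Fin 3 → ℤ) {y : Space R}
    (hy : y ∈ ladderSub R (ladder z₀ (W₁.phase i).m)) : hopL W₁ R i y ∈ ladderSub R (ladder z₀ (W₁.phase i).m) :=
  hopL_mem_ladderSub W₁ i (fun _ h => add_mem_ladder_iff.1 h) (fun _ h => sub_mem_ladder_iff.1 h) hy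

/-- The bond operator `K hopL − hopL K` preserves the ladder subspace of an `mᵢ`-ladder. [cite: BedrossianCotiZelati2017, §2] -/
theorem bond_mem_ladderSub_ladder (W₁ : LatticeWord k₀) {R : ℕ} (i : Fin k₀) (z₀ : Fin 3 → ℤ) {y : Space R}
    (hy : y ∈ ladderSub R (ladder z₀ (W₁.phase i).m)) :
    indexL R (W₁.phase i).m (hopL W₁ R i y) - hopL W₁ R i (indexL R (W₁.phase i).m y) ∈ ladderSub R (ladder z₀ (W₁.phase i).m) :=
  Submodule.sub_mem _ (indexL_mem_ladderSub _ (hopL_mem_ladderSub_ladder W₁ i z₀ hy))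
    (hopL_mem_ladderSub_ladder W₁ i z₀ (indexL_mem_ladderSub _ hy))

end Summit.AnomalousDissipation.AnomalousDissipation.Theorems.SolenoidalFractalHomogenisation.LagrangianStep.Sideband

end
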